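/-
Copyright (c) 2026 the pub-hodgecm-mathlib formalisation cell (harness21).  Prover seat hodgecm-mathlib-K2E1-p13 (g3) acting as R90-CS «p07b» (R90-TF section S8 «ContSpec-n½»,
planner R90-CS-plan (g0), ruling S8-R5 (ii)): the L-FUNCTION HALF of R2-χ ∕ R4-χ of the road `R90/S8/ROAD-S8B2.K2E1-p13-g3.md` — the unramified `χ`-scalar
`L^S(2z−1, χ₀)∕L^S(2z, χ₀)` of the `U(J₂)` intertwining operator: Euler product, continuation to `Re z > ½`, and the pole dichotomy «pole ⟺ χ₀ = 1».
-/
import Summits.HodgeConjecture.HodgeConjecture.Theorems.K2E1IntertwiningScalarContinuationU2   -- ★ the `χ₀ = 1` case VERBATIM (`exists_differentiableOn_sub_one_mul_scalar`); brings ★ `K2LiuSiegelIntertwiningScalarGL1` (`exists_entire_eq_partialL`), ★ `F0P2wPartialDedekindZetaPole`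
import HarnessLib

/-!
# K2·E1 ∕ R90·S8 — `K2E1ChiIntertwiningScalarEulerQuotientU2`: THE UNRAMIFIED `χ`-SCALAR `c_χ^S(z) = L^S(2z−1, χ₀)∕L^S(2z, χ₀)` OF THE STANDARD INTERTWINING OPERATOR OF
# `U(J₂)` — EULER PRODUCT ON `Re z > 1`, HOLOMORPHIC CONTINUATION TO `Re z > ½` WHEN `χ₀ ≠ 1`, AND THE DICHOTOMY «a pole on `Re z > ½` ⟺ `χ₀ = 1` (then one, simple, at `z = 1`)»

Cell `pub/hodgecm-mathlib`, crux h413 = `stmt-HodgeConjecture-24833`, route of record `HCCMUnconditional`; R90-TF section S8, socket S8B#4 («`L²_res(U(Φ₂)) = ⊕ ℂ·ψ∘det`»), road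
`R90/S8/ROAD-S8B2.K2E1-p13-g3.md` items R2-χ∕R3∕R4-χ.  THEOREMS ONLY (no `def`, no `instance`, no notation, no named-fact hypothesis, no `sorry`; default heartbeats); lane
`--supports stmt-HodgeConjecture-24833 --as helper` (count-neutral).

THE MATHEMATICS ([Rogawski1990, §13.9 p. 229; Prop. 10.4.1]; [MoeglinWaldspurger1995, IV.1.11]; [Langlands1976, Appendix]).  For the quasi-split `U(1,1) = U(J₂)` of `E∕F` and a unitary
Hecke character `χ` of `E` with restriction `χ₀ := χ|_{𝔸_F^×}` (a unitary Hecke character of `F`), the standard intertwining operator `M(w₀, χ_z)` acts on the `χ`-spherical vector at an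
unramified place `v` of `F` by the scalar `c_{χ,v}(z) = L_v(2z−1, χ₀)∕L_v(2z, χ₀) = (1 − χ₀(ϖ_v)q_v^{−2z})·(1 − χ₀(ϖ_v)q_v^{−(2z−1)})⁻¹` (E1's normalisation `z`, `ρ_B ↦ z = 1`; `χ₀ = 1` is
★ `K2E1IntertwiningScalarContinuationU2`: `ζ_F^S(2z−1)∕ζ_F^S(2z)`).  THIS FILE is the `L`-function half of that statement, for ANY number field `F` and ANY unitary Hecke character `ε` of `F`
(read `ε = χ₀`): §1 the Euler product `∏'_{v∉S} c_{ε,v}(z) = L^S(2z−1,ε)∕L^S(2z,ε) ≠ 0` on `Re z > 1` (★ `hasProd_partialStandardL_singleton`); §2 the denominator `L^S(2z,ε)` is holomorphic and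
zero-free on `Re z > ½` (Euler region); §3 for `ε ≠ 1` (trivial on `ℝ_{>0}`, unramified off the finite `S`) the numerator `L^S(2z−1,ε)` is the restriction of an ENTIRE function (Hecke ★
`exists_entire_eq_partialL`), so **`c_ε^S` is HOLOMORPHIC on `Re z > ½` — no pole at all**; §4 THE DICHOTOMY: `(z − 1)·c_ε^S(z) = G(z)` with `G` holomorphic on `Re z > ½` and **`G(1) ≠ 0 ⟺ ε = 1`**
— the unramified `χ`-scalar of `U(J₂)` has a pole on `Re z > ½` iff `χ₀ = 1`, and then exactly one, simple, at `z = 1` (= case (i) of §13.9 at `N = 2`: the residues are the character lines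
`ψ∘det`, cf. ★ `R90S8CharLineResidual`); §5 the CM reading `F = L⁺`.
HONEST SCOPE.  Not here (FILE 2 of R2-χ, M–L): the LOCAL identification «the `χ`-twisted intertwining integral on the `χ`-spherical vector equals `c_{χ,v}(z)`» (the torus part of the Iwasawa
decomposition of `w₀n(x)`; ★ `K2E1IntertwiningLocalFactorU2*` are height-only) and the bad-place∕archimedean factors relating `c_χ^S` to the scattering coefficient `qc` of the ★ packages.
HONEST LABEL: HC_CM is proved only modulo the 7 printed citations (2 remaining named inputs: hLiu418 = `stmt-HodgeConjecture-24832`, h413 = `stmt-HodgeConjecture-24833`) until rung 0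
closes; REL ≠ ★ ≠ BUILT; count-neutral helper; closes no socket.

## References
* [Rogawski1990] J. D. Rogawski, *Automorphic Representations of Unitary Groups in Three Variables* (1990): §13.9 p. 229 (`M(s)`, cases (i)∕(ii)), Prop. 10.4.1.
* [MoeglinWaldspurger1995] C. Mœglin, J.-L. Waldspurger, *Spectral Decomposition and Eisenstein Series* (1995): IV.1.11 (poles of `M(w, s)` in the positive chamber), I.2.18.
* [Langlands1976] R. P. Langlands, *On the Functional Equations Satisfied by Eisenstein Series*, LNM 544 (1976): Appendix (rank one).
* [NeukirchANT1999] J. Neukirch, *Algebraic Number Theory* (1999): Ch. VII (5.2), Cor. (5.11), §8 (8.5) (Hecke `L`-series: Euler product, continuation).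
* [Iwasawa2019] K. Iwasawa, *Hecke's L-functions* (2019): Thm. 3.1 (entire continuation for `ε ≠ 1`).
-/

set_option autoImplicit false
set_option linter.dupNamespace false  -- the mandated namespace repeats the summit's segment (`HodgeConjecture.HodgeConjecture`)

noncomputable section

open scoped NNReal
open Filter Topology Complex NumberField IsDedekindDomain
open Literature.NumberTheory.Automorphic Literature.NumberTheory.LFunctions Literature.NumberTheory.GaloisRepresentations
open Summit.HodgeConjecture.HodgeConjecture.Cruxes.H413.F0P2wPartialDedekindZetaPole
open Summit.HodgeConjecture.HodgeConjecture.Cruxes.HLiu418.K2LiuSiegelIntertwiningScalarGL1 (norm_valueAtUniformizer_le_one exists_entire_eq_partialL re_two_mul_shifts)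
open Summit.HodgeConjecture.HodgeConjecture.Cruxes.H413.K2E1IntertwiningScalarContinuationU2 (exists_differentiableOn_sub_one_mul_scalar)

namespace Summit.HodgeConjecture.HodgeConjecture.Cruxes.H413.K2E1ChiIntertwiningScalarEulerQuotientU2

variable {F : Type} [Field F] [NumberField F] {ε : HeckeCharacter F} {S : Set (HeightOneSpectrum (𝓞 F))}

/-! ## §1 Euler products on `Re z > 1`: numerator, denominator, and the product of the local `χ`-scalars -/

/-- **NUMERATOR `L^S(2z−1, ε)` as an Euler product, `Re z > 1`**: `HasProd` of `(1 − ε(ϖ_v)q_v^{−(2z−1)})⁻¹` over `v ∉ S`, value `≠ 0`. [cite: NeukirchANT1999, Ch. VII §8 (8.5)] -/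
theorem hasProd_chiNum (hε : ε.IsUnitary) {z : ℂ} (hz : 1 < z.re) :
    HasProd (fun v : {v : HeightOneSpectrum (𝓞 F) // v ∉ S} => (1 - ε.valueAtUniformizer v.1 * (v.1.residueCard : ℂ) ^ (-(2 * z - 1)))⁻¹)
      (partialStandardL S (fun v => {ε.valueAtUniformizer v}) (2 * z - 1)) ∧
    partialStandardL S (fun v => {ε.valueAtUniformizer v}) (2 * z - 1) ≠ 0 :=
  hasProd_partialStandardL_singleton (S := S) (fun v => ε.valueAtUniformizer v) (norm_valueAtUniformizer_le_one hε S) (s := 2 * z - 1)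
    (by rw [(re_two_mul_shifts z).2.1]; linarith)

/-- **DENOMINATOR `L^S(2z, ε)` as an Euler product, already on `Re z > ½`**: `HasProd` of `(1 − ε(ϖ_v)q_v^{−2z})⁻¹` over `v ∉ S`, value `≠ 0` (the Euler region `Re 2z > 1`).
[cite: NeukirchANT1999, Ch. VII §8 (8.5)] -/
theorem hasProd_chiDen (hε : ε.IsUnitary) {z : ℂ} (hz : 1 / 2 < z.re) :
    HasProd (fun v : {v : HeightOneSpectrum (𝓞 F) // v ∉ S} => (1 - ε.valueAtUniformizer v.1 * (v.1.residueCard : ℂ) ^ (-(2 * z)))⁻¹)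
      (partialStandardL S (fun v => {ε.valueAtUniformizer v}) (2 * z)) ∧
    partialStandardL S (fun v => {ε.valueAtUniformizer v}) (2 * z) ≠ 0 :=
  hasProd_partialStandardL_singleton (S := S) (fun v => ε.valueAtUniformizer v) (norm_valueAtUniformizer_le_one hε S) (s := 2 * z)
    (by rw [(re_two_mul_shifts z).1]; linarith)

/-- **THE EULER PRODUCT OF THE LOCAL `χ`-SCALARS IS `c_ε^S(z) = L^S(2z−1, ε)∕L^S(2z, ε)`, `Re z > 1`, AND IT IS `≠ 0` THERE**: at an unramified `v ∉ S` the local scalar of `M(w₀, χ_z)` on the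
`χ`-spherical vector of `U(J₂)` is `(1 − ε_v q_v^{−2z})·(1 − ε_v q_v^{−(2z−1)})⁻¹ = L_v(2z−1,ε)∕L_v(2z,ε)`, `ε_v = χ₀(ϖ_v)`; the product `HasProd`-converges (numerator §1 times the inverted
denominator product, `Finset.prod_inv_distrib`).  At `ε = 1` this is ★ `K2E1IntertwiningScalarContinuationU2.hasProd_localScalar`. [cite: Rogawski1990, §13.9 p. 229] [cite: Langlands1976, Appendix] -/
theorem hasProd_chiLocalScalar (hε : ε.IsUnitary) {z : ℂ} (hz : 1 < z.re) :
    HasProd (fun v : {v : HeightOneSpectrum (𝓞 F) // v ∉ S} =>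
        (1 - ε.valueAtUniformizer v.1 * (v.1.residueCard : ℂ) ^ (-(2 * z))) * (1 - ε.valueAtUniformizer v.1 * (v.1.residueCard : ℂ) ^ (-(2 * z - 1)))⁻¹)
      (partialStandardL S (fun v => {ε.valueAtUniformizer v}) (2 * z - 1) / partialStandardL S (fun v => {ε.valueAtUniformizer v}) (2 * z)) ∧
    partialStandardL S (fun v => {ε.valueAtUniformizer v}) (2 * z - 1) / partialStandardL S (fun v => {ε.valueAtUniformizer v}) (2 * z) ≠ 0 := by
  have hnum := hasProd_chiNum (S := S) hε hz
  have hden := hasProd_chiDen (S := S) hε (show 1 / 2 < z.re by linarith)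
  -- invert the denominator's Euler product
  have hdinv : HasProd (fun v : {v : HeightOneSpectrum (𝓞 F) // v ∉ S} => ((1 - ε.valueAtUniformizer v.1 * (v.1.residueCard : ℂ) ^ (-(2 * z)))⁻¹)⁻¹)
      (partialStandardL S (fun v => {ε.valueAtUniformizer v}) (2 * z))⁻¹ := by
    have h := hden.1
    unfold HasProd at h ⊢
    simpa only [Finset.prod_inv_distrib] using h.inv₀ hden.2
  refine ⟨?_, div_ne_zero hnum.2 hden.2⟩
  have key : HasProd (fun v : {v : HeightOneSpectrum (𝓞 F) // v ∉ S} =>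
        (1 - ε.valueAtUniformizer v.1 * (v.1.residueCard : ℂ) ^ (-(2 * z))) * (1 - ε.valueAtUniformizer v.1 * (v.1.residueCard : ℂ) ^ (-(2 * z - 1)))⁻¹)
      ((partialStandardL S (fun v => {ε.valueAtUniformizer v}) (2 * z))⁻¹ * partialStandardL S (fun v => {ε.valueAtUniformizer v}) (2 * z - 1)) :=
    (hdinv.mul hnum.1).congr_fun fun v => by simp only [inv_inv]
  rwa [inv_mul_eq_div] at key

/-! ## §2 The denominator `L^S(2z, ε)` on the open half-plane `Re z > ½`: holomorphic and zero-free -/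

/-- **`z ↦ L^S(2z, ε)` is holomorphic on `{Re z > ½}`** (★ `differentiableOn_partialStandardL_singleton` on `Re > 1`, composed with `z ↦ 2z`). [cite: NeukirchANT1999, Ch. VII §8 (8.5)] -/
theorem differentiableOn_chiDen (hε : ε.IsUnitary) :
    DifferentiableOn ℂ (fun z : ℂ => partialStandardL S (fun v => {ε.valueAtUniformizer v}) (2 * z)) {z : ℂ | 1 / 2 < z.re} :=
  (differentiableOn_partialStandardL_singleton _ (norm_valueAtUniformizer_le_one hε S)).comp ((differentiableOn_const _).mul differentiableOn_id) fun z hz => by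
    have hz' : 1 / 2 < z.re := hz
    show 1 < (2 * z).re
    rw [(re_two_mul_shifts z).1]; linarith

/-- **`L^S(2z, ε) ≠ 0` for `Re z > ½`** (absolutely convergent Euler product). [cite: NeukirchANT1999, Ch. VII §8 (8.5)] -/
theorem chiDen_ne_zero (hε : ε.IsUnitary) {z : ℂ} (hz : 1 / 2 < z.re) : partialStandardL S (fun v => {ε.valueAtUniformizer v}) (2 * z) ≠ 0 :=
  (hasProd_chiDen (S := S) hε hz).2

/-! ## §3 `ε ≠ 1`: the numerator is entire, so the `χ`-scalar is HOLOMORPHIC on `Re z > ½` -/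

/-- **THE NUMERATOR FOR `ε ≠ 1` IS THE RESTRICTION OF AN ENTIRE FUNCTION**: `L^S(2z−1, ε) = A(z)` on `Re z > 1` with `A(z) = g(2z−1)`, `g` Hecke's entire continuation of `L^S(·, ε)` (★
`exists_entire_eq_partialL`: unitary, trivial on `ℝ_{>0}`, `ε ≠ 1`, unramified off the finite `S`). [cite: Iwasawa2019, Thm. 3.1] [cite: NeukirchANT1999, Ch. VII Cor. (5.11)] -/
theorem exists_entire_eq_chiNum (hε : ε.IsUnitary) (hA : ∀ t : ℝ≥0ˣ, ε (posRealIdele F t) = 1) (h1 : ε ≠ 1) (hS : S.Finite) (hur : ∀ v ∉ S, ε.IsUnramifiedAt v) :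
    ∃ A : ℂ → ℂ, Differentiable ℂ A ∧ ∀ z : ℂ, 1 < z.re → partialStandardL S (fun v => {ε.valueAtUniformizer v}) (2 * z - 1) = A z := by
  obtain ⟨g, hg, -, hg_eq⟩ := exists_entire_eq_partialL hε hA h1 hS hur
  refine ⟨fun z => g (2 * z - 1), hg.comp (((differentiable_const _).mul differentiable_id).sub (differentiable_const _)), fun z hz => ?_⟩
  exact hg_eq (2 * z - 1) (by rw [(re_two_mul_shifts z).2.1]; linarith)

/-- **`χ₀ ≠ 1` ⟹ THE UNRAMIFIED `χ`-SCALAR OF `U(J₂)` IS HOLOMORPHIC ON `Re z > ½` — NO POLE AT ALL.**  For a unitary Hecke character `ε ≠ 1` of `F` trivial on `ℝ_{>0}` and unramified off the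
finite `S` there is `G` HOLOMORPHIC on `{Re z > ½}` with `L^S(2z−1, ε)∕L^S(2z, ε) = G(z)` for `Re z > 1` (`G = A∕L^S(2·, ε)`, §3 over §2).  So for `χ₀ ≠ 1` the `χ`-Eisenstein series of `U(1,1)`
acquires NO residue from the unramified scalar anywhere on `Re z > ½` — in particular none in the «complementary window» `(½, 1)` and none at `z = 1`. [cite: Rogawski1990, §13.9 p. 229]
[cite: MoeglinWaldspurger1995, IV.1.11] [cite: Iwasawa2019, Thm. 3.1] -/
theorem exists_differentiableOn_chiScalar (hε : ε.IsUnitary) (hA : ∀ t : ℝ≥0ˣ, ε (posRealIdele F t) = 1) (h1 : ε ≠ 1) (hS : S.Finite) (hur : ∀ v ∉ S, ε.IsUnramifiedAt v) :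
    ∃ G : ℂ → ℂ, DifferentiableOn ℂ G {z : ℂ | 1 / 2 < z.re} ∧ ∀ z : ℂ, 1 < z.re →
      partialStandardL S (fun v => {ε.valueAtUniformizer v}) (2 * z - 1) / partialStandardL S (fun v => {ε.valueAtUniformizer v}) (2 * z) = G z := by
  obtain ⟨A, hA', hA_eq⟩ := exists_entire_eq_chiNum hε hA h1 hS hur
  refine ⟨fun z => A z / partialStandardL S (fun v => {ε.valueAtUniformizer v}) (2 * z),
    hA'.differentiableOn.div (differentiableOn_chiDen hε) fun z hz => chiDen_ne_zero hε hz, fun z hz => ?_⟩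
  show _ = A z / _
  rw [hA_eq z hz]

/-! ## §4 THE DICHOTOMY: a pole on `Re z > ½` iff `ε = 1`, and then exactly one, simple, at `z = 1` -/

/-- **R4-χ — THE POLE DICHOTOMY OF THE UNRAMIFIED `χ`-SCALAR OF `U(J₂)`.**  For a number field `F`, a unitary Hecke character `ε` of `F` trivial on the diagonal positive reals and
unramified off the finite set `S` of finite places, there is `G` HOLOMORPHIC on `{Re z > ½}` with
  `(z − 1) · L^S(2z−1, ε)∕L^S(2z, ε) = G(z)` for `Re z > 1`,   and   `G(1) ≠ 0 ⟺ ε = 1`.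
So `c_ε^S = G∕(z − 1)` continues meromorphically to `Re z > ½` with NO singularity off `z = 1`, and at `z = 1` a GENUINE simple pole exactly when `ε = 1` (★ `exists_differentiableOn_sub_one_mul_scalar`:
`G(1) = ½ρ_F E_S(1)∕ζ_F^S(2) ≠ 0`) and a removable one (`G(1) = 0`) when `ε ≠ 1` (§3).  Read with `ε = χ₀ = χ|_{𝔸_{L⁺}^×}`: the residual spectrum of `U(1,1)` fed by the Borel `χ`-Eisenstein series
comes ONLY from `χ₀ = 1`, at `z = 1` — case (i) of [Rogawski1990, §13.9] at `N = 2`, whose residues are the character lines `ψ∘det` (★ `R90S8CharLineResidual`).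
[cite: Rogawski1990, §13.9 p. 229] [cite: MoeglinWaldspurger1995, IV.1.11] [cite: Langlands1976, Appendix] [cite: NeukirchANT1999, Ch. VII Cor. (5.11)] -/
theorem exists_differentiableOn_sub_one_mul_chiScalar (hε : ε.IsUnitary) (hA : ∀ t : ℝ≥0ˣ, ε (posRealIdele F t) = 1) (hS : S.Finite) (hur : ∀ v ∉ S, ε.IsUnramifiedAt v) :
    ∃ G : ℂ → ℂ, DifferentiableOn ℂ G {z : ℂ | 1 / 2 < z.re} ∧
      (∀ z : ℂ, 1 < z.re →
        (z - 1) * (partialStandardL S (fun v => {ε.valueAtUniformizer v}) (2 * z - 1) / partialStandardL S (fun v => {ε.valueAtUniformizer v}) (2 * z)) = G z) ∧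
      (G 1 ≠ 0 ↔ ε = 1) := by
  by_cases h1 : ε = 1
  · subst h1
    have hfun : (fun v : HeightOneSpectrum (𝓞 F) => ({(1 : HeckeCharacter F).valueAtUniformizer v} : Multiset ℂ)) = fun _ => {1} :=
      funext fun _ => rfl  -- `(1 : HeckeCharacter F).valueAtUniformizer v = 1` definitionally (★ `one_valueAtUniformizer`)
    obtain ⟨G, hG, hG_eq, hG1⟩ := exists_differentiableOn_sub_one_mul_scalar (F := F) (S := S) hS
    refine ⟨G, hG, fun z hz => ?_, iff_of_true hG1 rfl⟩
    rw [hfun]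
    exact hG_eq z hz
  · obtain ⟨G, hG, hG_eq⟩ := exists_differentiableOn_chiScalar hε hA h1 hS hur
    refine ⟨fun z => (z - 1) * G z, ((differentiableOn_id.sub (differentiableOn_const _)).mul hG), fun z hz => by rw [hG_eq z hz], ?_⟩
    simp only [sub_self, zero_mul, ne_eq, not_true_eq_false, false_iff]
    exact h1

/-! ## §5 The CM reading `F = L⁺` -/

section CM

variable (L : Type) [Field L] [NumberField L]

/-- **THE CM PRINT (`U(1,1)_{L∕L⁺}`)**: for a unitary Hecke character `ε` of `L⁺` (the restriction `χ₀` of the cuspidal datum `χ` of the Borel of `U(Φ₂)`), trivial on `ℝ_{>0}` and unramified off the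
finite `S`: `(z − 1)·L^S(2z−1, ε)∕L^S(2z, ε) = G(z)` on `Re z > 1` with `G` holomorphic on `Re z > ½` and `G(1) ≠ 0 ⟺ ε = 1` — the pole set of the unramified `χ`-scalar on `Re z > ½` is `{1}` if
`χ₀ = 1` and `∅` otherwise. [cite: Rogawski1990, §13.9 p. 229] [cite: MoeglinWaldspurger1995, IV.1.11] -/
theorem exists_differentiableOn_sub_one_mul_chiScalar_cm {ε : HeckeCharacter ↥(maximalRealSubfield L)} {S : Set (HeightOneSpectrum (𝓞 ↥(maximalRealSubfield L)))}
    (hε : ε.IsUnitary) (hA : ∀ t : ℝ≥0ˣ, ε (posRealIdele ↥(maximalRealSubfield L) t) = 1) (hS : S.Finite) (hur : ∀ v ∉ S, ε.IsUnramifiedAt v) :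
    ∃ G : ℂ → ℂ, DifferentiableOn ℂ G {z : ℂ | 1 / 2 < z.re} ∧
      (∀ z : ℂ, 1 < z.re →
        (z - 1) * (partialStandardL S (fun v => {ε.valueAtUniformizer v}) (2 * z - 1) / partialStandardL S (fun v => {ε.valueAtUniformizer v}) (2 * z)) = G z) ∧
      (G 1 ≠ 0 ↔ ε = 1) :=
  exists_differentiableOn_sub_one_mul_chiScalar hε hA hS hur

end CM

end Summit.HodgeConjecture.HodgeConjecture.Cruxes.H413.K2E1ChiIntertwiningScalarEulerQuotientU2

end
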